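import Summits.BirchSwinnertonDyer.BirchSwinnertonDyer.Theorems.ErratumRoadFiveNonSurjCornerTwinMuAnCongruenceDoor
import Literature.NumberTheory.Automorphic.CDTTheorem722SerreProofs
import Literature.NumberTheory.EllipticCurves.LFunctionPrimeCoeff
import HarnessLib

/-!
# Route `ErratumRoadFive` (K2), crux `NonSurjCorner` (19065), child `NonSurjCornerTwinMuAn` (item stmt-BirchSwinnertonDyer-19948):
# THE NEWFORM-CLASS DOOR — two curves attached to the SAME weight-2 newform class `(f, ι)` are trace-congruent, so ONE `μ_an = 0` certificate per class `(f, ι)`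
# (cell `bsd-stepL`, WIDTH-LEVER lane B `bsd-stepL-corner5-p2` g10; `--supports stmt-BirchSwinnertonDyer-19948 --as helper`)

WHY. The Serre-level door (p628991) attaches to every corner member `Wd` a weight-2 newform class `(f, ιf)` of level dividing the additive conductor:
`Wd[p] ⊗ 𝔽̄_p ≅ ρ̄_{f,ι}` in the tree's sense `IsGaloisRepOfNewform1Int f ιf S ρ̄'` (equal Frobenius characteristic polynomials off `S`). Lane B's Serre-level
census enumerates these classes and computes ONE certificate per class. This file is the kernel statement that one certificate per class suffices: two globally
minimal curves whose framed mod-`p` representations are attached to the same `(f, ιf)` off `S` have `a_ℓ(W) ≡ a_ℓ(W₁) (mod p)` at every good prime `ℓ ∉ S`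
(`ℓ ≠ p`) — the integral Hecke polynomial of `f` at `ℓ` is unique (`𝓞_f[X] → K_f[X]` is injective), both Frobenius polynomials are its image under `ιf`, and the
Frobenius polynomial of `E[p] ⊗ 𝔽̄_p` at `ℓ` is `X² − a_ℓ(E) X + ℓ` (tree theorem `charpoly_baseChange_of_isTorsionGaloisRep` with `a_ℓ = ` Mathlib's
`LFunction ℓ = frobeniusTrace ℓ` at a good prime, `LFunction_apply_prime_eq_frobeniusTrace`); then the trace-congruence door (p632969) moves the certificate.

* §1 `NonSurjTwin.frobeniusTrace_congr_of_sameNewformClass` — the congruence of traces off `S ∪ {p}` from a common `(f, ιf)`.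
* §2 `NonSurjTwin.muAnZeroAt_of_sameNewformClass_mult ∕ _good` — the door: at a pair `(Wd, p)` with `p ≥ 5`, `Wd` multiplicative at `p`, `Wd[p]` irreducible,
  the lane certificate follows from that of ANY globally minimal `W₁` (multiplicative, resp. good ordinary at `p`) in the same newform class (mod the EPW fact).

HONEST FRAMING: CONDITIONAL on the named EPW facts exactly as p621412 ∕ p632969; no `sorry`, no definition, no new named fact; 19948 is NOT closed; BSD is proved
for no curve. [cite: EmertonPollackWeston2006, Thm. 1 (arXiv:math/0404484 p. 2)] [cite: DeligneSerreASENS1974, Thm. 6.1] [cite: DarmonDiamondTaylor1995, Prop. 2.6 (b)]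
-/

set_option linter.dupNamespace false -- `Summit.BirchSwinnertonDyer.BirchSwinnertonDyer` (summit = problem), tree-wide

noncomputable section

open scoped Classical MatrixGroups ModularForm NumberField

namespace Summit.BirchSwinnertonDyer.BirchSwinnertonDyer.Theorems

open CongruenceSubgroup WeierstrassCurve Literature.NumberTheory.EllipticCurves
  Literature.NumberTheory.EllipticCurves.ModularForms
  Literature.NumberTheory.EllipticCurves.Rank1Residual
  Literature.NumberTheory.EllipticCurves.GreenbergVatsal2000
  Literature.NumberTheory.EllipticCurves.EmertonPollackWeston2006
  Literature.NumberTheory.GaloisRepresentations Literature.NumberTheory.Automorphic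
  Literature.NumberTheory.Automorphic.BCDT
  IsDedekindDomain IsDedekindDomain.HeightOneSpectrum Rat.HeightOneSpectrum NumberField Polynomial
  Summit.BirchSwinnertonDyer.Rank1Residual

/-! ### §1 Two curves in one newform class are trace-congruent -/

/-- **Same newform class ⟹ congruent traces.** `W, W₁ / ℚ` globally minimal with framed mod-`p` representations `ρ, ρ₁` (`IsTorsionGaloisRep`); if
`ρ ⊗ 𝔽̄_p` and `ρ₁ ⊗ 𝔽̄_p` are both attached to the same newform `f ∈ S₂(Γ₁(M))` and reduction map `ιf : 𝓞_f → 𝔽̄_p` off the set `S`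
(`IsGaloisRepOfNewform1Int`), then `p ∣ a_ℓ(W) − a_ℓ(W₁)` at every prime `ℓ ∉ S`, `ℓ ≠ p`, good for both: at an arithmetic Frobenius `σ` above `ℓ` both
characteristic polynomials equal `ιf(P_ℓ)` for THE integral Hecke polynomial `P_ℓ` (unique: `𝓞_f[X] ↪ K_f[X]`), while they are `X² − a_ℓ X + ℓ` with
`a_ℓ = a_ℓ(W)`, resp. `a_ℓ(W₁)` (mod `p`); compare the `X`-coefficients and pull back along `𝔽_p ↪ 𝔽̄_p`.
[cite: DeligneSerreASENS1974, Thm. 6.1, (6.1.1)] [cite: DarmonDiamondTaylor1995, Prop. 2.11 (a)] -/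
theorem NonSurjTwin.frobeniusTrace_congr_of_sameNewformClass
    (W W₁ : WeierstrassCurve ℚ) [W.IsElliptic] [W.IsGloballyMinimal] [W₁.IsElliptic] [W₁.IsGloballyMinimal]
    (p : ℕ) [Fact p.Prime]
    [TopologicalSpace (AlgebraicClosure (ZMod p))] [DiscreteTopology (AlgebraicClosure (ZMod p))]
    {ρ ρ₁ : ModPGaloisRep ℚ (ZMod p) 2} (hρ : W.IsTorsionGaloisRep p ρ) (hρ₁ : W₁.IsTorsionGaloisRep p ρ₁)
    {M : ℕ} [NeZero M] {f : CuspForm (Gamma1 M) 2} (ιf : coeffCharIntegers f →+* AlgebraicClosure (ZMod p)) (S : Set ℕ)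
    (h : IsGaloisRepOfNewform1Int f ιf S
      (FramedRep.baseChange (algebraMap (ZMod p) (AlgebraicClosure (ZMod p))) continuous_of_discreteTopology ρ))
    (h₁ : IsGaloisRepOfNewform1Int f ιf S
      (FramedRep.baseChange (algebraMap (ZMod p) (AlgebraicClosure (ZMod p))) continuous_of_discreteTopology ρ₁))
    (ℓ : ℕ) [hℓ : Fact ℓ.Prime] (hℓS : ℓ ∉ S) (hℓp : ℓ ≠ p)
    (hg : W.HasGoodReductionAtPrime ℓ) (hg₁ : W₁.HasGoodReductionAtPrime ℓ) :
    (p : ℤ) ∣ W.frobeniusTrace ℓ - W₁.frobeniusTrace ℓ := by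
  set j : ZMod p →+* AlgebraicClosure (ZMod p) := algebraMap (ZMod p) (AlgebraicClosure (ZMod p)) with hj
  -- the place `v` of `𝓞 ℚ` over `ℓ`, a prime `𝔓 ∣ v` of `ℤ̄` and an arithmetic Frobenius `σ`
  obtain ⟨v, rfl⟩ : ∃ v : HeightOneSpectrum (𝓞 ℚ), (primesEquiv v : ℕ) = ℓ :=
    ⟨primesEquiv.symm ⟨ℓ, hℓ.out⟩, by rw [Equiv.apply_symm_apply]⟩
  obtain ⟨𝔓, h𝔓⟩ := HeightOneSpectrum.primesAbove_nonempty v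
  obtain ⟨σ, hσ⟩ := HeightOneSpectrum.exists_isArithFrobAt_of_mem_primesAbove_holds h𝔓
  have hvS : ((primesEquiv v : Nat.Primes) : ℕ) ∉ S := hℓS
  obtain ⟨-, P, hP, hPc⟩ := h v hvS
  obtain ⟨-, P₁, hP₁, hP₁c⟩ := h₁ v hvS
  -- the integral Hecke polynomial is unique
  have hPP : P = P₁ :=
    Polynomial.map_injective (algebraMap (coeffCharIntegers f) (coeffCharField f)) (fun _ _ e ↦ Subtype.ext e)
      (hP.trans hP₁.symm)
  -- both Frobenius polynomials at `σ`
  have hc : FramedRep.charpoly (FramedRep.baseChange j continuous_of_discreteTopology ρ) σ = P.map ιf := hPc 𝔓 h𝔓 σ hσ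
  have hc₁ : FramedRep.charpoly (FramedRep.baseChange j continuous_of_discreteTopology ρ₁) σ = P₁.map ιf := hP₁c 𝔓 h𝔓 σ hσ
  have hvp : (primesEquiv v : ℕ) ≠ p := hℓp
  have hgv : W.HasGoodReductionAt v := (W.hasGoodReductionAtPrime_iff_hasGoodReductionAt_ringOfIntegers (v := v)).mp hg
  have hgv₁ : W₁.HasGoodReductionAt v := (W₁.hasGoodReductionAtPrime_iff_hasGoodReductionAt_ringOfIntegers (v := v)).mp hg₁
  have e := charpoly_baseChange_of_isTorsionGaloisRep W hρ j continuous_of_discreteTopology hvp hgv h𝔓 hσ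
  have e₁ := charpoly_baseChange_of_isTorsionGaloisRep W₁ hρ₁ j continuous_of_discreteTopology hvp hgv₁ h𝔓 hσ
  -- compare the `X`-coefficients
  have hX : (X ^ 2 - C ((W.LFunction (primesEquiv v : ℕ) : ℤ) : AlgebraicClosure (ZMod p)) * X +
      C ((primesEquiv v : ℕ) : AlgebraicClosure (ZMod p))).coeff 1 =
      (X ^ 2 - C ((W₁.LFunction (primesEquiv v : ℕ) : ℤ) : AlgebraicClosure (ZMod p)) * X +
      C ((primesEquiv v : ℕ) : AlgebraicClosure (ZMod p))).coeff 1 := by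
    rw [← e, ← e₁, hc, hc₁, hPP]
  simp only [coeff_add, coeff_sub, coeff_C_mul, coeff_X_pow, coeff_X_one, coeff_C, if_neg (show (1 : ℕ) ≠ 2 by decide),
    if_neg (show (1 : ℕ) ≠ 0 by decide), mul_one, zero_sub, add_zero, neg_inj] at hX
  rw [W.LFunction_apply_prime_eq_frobeniusTrace _ hg, W₁.LFunction_apply_prime_eq_frobeniusTrace _ hg₁] at hX
  -- pull back along `𝔽_p ↪ 𝔽̄_p`
  have hX' : algebraMap (ZMod p) (AlgebraicClosure (ZMod p)) (W.frobeniusTrace (primesEquiv v : ℕ) : ZMod p) =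
      algebraMap (ZMod p) (AlgebraicClosure (ZMod p)) (W₁.frobeniusTrace (primesEquiv v : ℕ) : ZMod p) := by
    simpa only [map_intCast] using hX
  have hZ : (W.frobeniusTrace (primesEquiv v : ℕ) : ZMod p) = (W₁.frobeniusTrace (primesEquiv v : ℕ) : ZMod p) :=
    (algebraMap (ZMod p) (AlgebraicClosure (ZMod p))).injective hX'
  exact (ZMod.intCast_eq_intCast_iff_dvd_sub _ _ p).mp hZ.symm

/-! ### §2 The newform-class door -/

/-- **NEWFORM-CLASS DOOR, multiplicative source.** `p ≥ 5`, `Wd` multiplicative at `p` with `Wd[p]` irreducible (every member of 19948's population), `W₁`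
globally minimal multiplicative at `p`; if the framed mod-`p` representations of `Wd` and `W₁` are attached to the SAME newform class `(f, ιf)` off a finite
set `S`, then `W₁`'s lane certificate gives `Wd`'s (mod the EPW fact): §1 + the trace-congruence door p632969. So one certificate per class `(f, ι)` — the unit of
the Serre-level census — suffices. CONDITIONAL on `hEPW`. [cite: EmertonPollackWeston2006, Thm. 1 (arXiv:math/0404484 p. 2)] [cite: DarmonDiamondTaylor1995, Prop. 2.6 (b)] -/
theorem NonSurjTwin.muAnZeroAt_of_sameNewformClass_mult (hEPW : thm1_muAn_transfer_mult_of_multiplicative)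
    (Wd W₁ : WeierstrassCurve ℚ) [Wd.IsElliptic] [Wd.IsGloballyMinimal] [W₁.IsElliptic] [W₁.IsGloballyMinimal]
    (p : ℕ) [Fact p.Prime] (hp : 5 ≤ p) (hmult : Mult Wd p) (hirr : Irr Wd p) (hm₁ : W₁.HasMultiplicativeReductionAtPrime p)
    [TopologicalSpace (AlgebraicClosure (ZMod p))] [DiscreteTopology (AlgebraicClosure (ZMod p))]
    {ρ ρ₁ : ModPGaloisRep ℚ (ZMod p) 2} (hρ : Wd.IsTorsionGaloisRep p ρ) (hρ₁ : W₁.IsTorsionGaloisRep p ρ₁)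
    {M : ℕ} [NeZero M] {f : CuspForm (Gamma1 M) 2} (ιf : coeffCharIntegers f →+* AlgebraicClosure (ZMod p))
    (S : Set ℕ) (hS : S.Finite)
    (h : IsGaloisRepOfNewform1Int f ιf S
      (FramedRep.baseChange (algebraMap (ZMod p) (AlgebraicClosure (ZMod p))) continuous_of_discreteTopology ρ))
    (h₁ : IsGaloisRepOfNewform1Int f ιf S
      (FramedRep.baseChange (algebraMap (ZMod p) (AlgebraicClosure (ZMod p))) continuous_of_discreteTopology ρ₁))
    (hμ₁ : X11a.MuAnZeroAt W₁ p) : X11a.MuAnZeroAt Wd p :=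
  NonSurjTwin.muAnZeroAt_of_frobeniusTrace_congr_mult hEPW Wd W₁ p hp hmult hirr hm₁ (S ∪ {p}) (hS.union (Set.finite_singleton p))
    (fun ℓ _ hℓ hg hg₁ ↦ NonSurjTwin.frobeniusTrace_congr_of_sameNewformClass Wd W₁ p hρ hρ₁ ιf S h h₁ ℓ
      (fun hS' ↦ hℓ (Or.inl hS')) (fun hp' ↦ hℓ (Or.inr hp')) hg hg₁) hμ₁

/-- **NEWFORM-CLASS DOOR, good-ordinary source.** Same with `W₁` GOOD ORDINARY at `p` and its certificate in the Néron shape (the typical census situation: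
the newform class is found at level prime to `p`, and when it is rational its curve `W₁` has good ordinary reduction at `p` with `a_p(W₁) ≡ ±1`).
CONDITIONAL on `hEPW`. [cite: EmertonPollackWeston2006, Thm. 1 (arXiv:math/0404484 p. 2)] [cite: DarmonDiamondTaylor1995, Prop. 2.6 (b)] -/
theorem NonSurjTwin.muAnZeroAt_of_sameNewformClass_good (hEPW : thm1_muAn_transfer_mult_of_goodOrdinary)
    (Wd W₁ : WeierstrassCurve ℚ) [Wd.IsElliptic] [Wd.IsGloballyMinimal] [W₁.IsElliptic] [W₁.IsGloballyMinimal]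
    (p : ℕ) [Fact p.Prime] (hp : 5 ≤ p) (hmult : Mult Wd p) (hirr : Irr Wd p) (hg₁ : GoodOrd W₁ p)
    [TopologicalSpace (AlgebraicClosure (ZMod p))] [DiscreteTopology (AlgebraicClosure (ZMod p))]
    {ρ ρ₁ : ModPGaloisRep ℚ (ZMod p) 2} (hρ : Wd.IsTorsionGaloisRep p ρ) (hρ₁ : W₁.IsTorsionGaloisRep p ρ₁)
    {M : ℕ} [NeZero M] {f : CuspForm (Gamma1 M) 2} (ιf : coeffCharIntegers f →+* AlgebraicClosure (ZMod p))
    (S : Set ℕ) (hS : S.Finite)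
    (h : IsGaloisRepOfNewform1Int f ιf S
      (FramedRep.baseChange (algebraMap (ZMod p) (AlgebraicClosure (ZMod p))) continuous_of_discreteTopology ρ))
    (h₁ : IsGaloisRepOfNewform1Int f ιf S
      (FramedRep.baseChange (algebraMap (ZMod p) (AlgebraicClosure (ZMod p))) continuous_of_discreteTopology ρ₁))
    (hμ₁ : ∀ [NeZero (W₁.conductorNorm ℤ)] (f₁ : CuspForm (Gamma0 (W₁.conductorNorm ℤ)) 2),
        IsNewformOf W₁ f₁ → ∀ (ϖ₁ : ℚ), (ϖ₁ : ℝ) * W₁.realPeriodRat = plusPeriod f₁ →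
      ∃ n : ℕ, ‖PowerSeries.coeff n
        (PowerSeries.C (ϖ₁ : ℚ_[p]) * padicLFunction f₁ (unitRoot W₁ p : ℚ_[p]))‖ = 1) :
    X11a.MuAnZeroAt Wd p :=
  NonSurjTwin.muAnZeroAt_of_frobeniusTrace_congr_good hEPW Wd W₁ p hp hmult hirr hg₁ (S ∪ {p}) (hS.union (Set.finite_singleton p))
    (fun ℓ _ hℓ hg hg' ↦ NonSurjTwin.frobeniusTrace_congr_of_sameNewformClass Wd W₁ p hρ hρ₁ ιf S h h₁ ℓ
      (fun hS' ↦ hℓ (Or.inl hS')) (fun hp' ↦ hℓ (Or.inr hp')) hg hg') @hμ₁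

end Summit.BirchSwinnertonDyer.BirchSwinnertonDyer.Theorems

end
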